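import Summits.Ventures.CertifiedArithmetic.Expansions.Orient2dEstimate

/-!
# `estimate` is sign-faithful on weakly nonoverlapping expansions

NEW WORK in the sense of this development (the routine and the class of expansions are Shewchuk's;
the theorem and its proof are ours).  `predicates.c`'s `estimate(elen, e)` sums the components of
an expansion smallest-first in floating point.  [Shewchuk1997, §2.7]'s "errs by less than an ulp"
is FALSE for a general nonoverlapping expansion (`Orient2dEstimate`: `⟨15/16, 15, −16⟩`, `p = 4`,
estimate `0`, sum `−1/16`), so the earlier files analysed `estimate` only on the four-component
block of `orient2dadapt` (`estimate_four_sign`, `estimate_four_eq_zero`, `Orient2dTailsZero*`).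
THIS FILE proves the structural statement: on every WEAKLY NONOVERLAPPING expansion of floats (the
class `W` of `WeakExpansion.lean` — pairwise `WeakBelow`, triplewise `NoDouble`; it contains every
strongly nonoverlapping expansion and is what EXPANSION-SUM / FAST-EXPANSION-SUM / SCALE-EXPANSION
preserve under ties-to-even), of ANY length, for ANY `p ≥ 2` and any round-to-nearest `fl`:
* `estimate_sign_of_isWeakExpansion` — `estimate > 0 ↔ Σ > 0` and `estimate < 0 ↔ Σ < 0`;
* `estimate_eq_zero_iff_of_isWeakExpansion` — `estimate = 0 ↔ Σ = 0`;
from one lemma valid for every nonoverlapping expansion (`IsExpansion 1`, `p ≥ 1`):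
* `abs_estimate_le_two_zpow` — components all `< 2^s` in magnitude ⟹ `|estimate| ≤ 2^s`.

PROOF.  Let `a = M·2^v` (`M` odd) be the top component; the others lie below `2^v`, so `Σ` has the
sign of `a` and their running sum `Q` has `|Q| ≤ 2^v`.  If `|M| ≥ 3`, `|Q| < |a|`.  If `a = ±2^v`,
`W` leaves two shapes: all others `< 2^(v−1)` (then `|Q| ≤ 2^(v−1)`), or one `x₀ = ±2^(v−1)` with
everything before it `< 2^(v−2)` (`NoDouble · x₀ a`) and only zeros after it — then
`|Q| ≤ 3·2^(v−2)`, a float for `p ≥ 2`.  So `|Q| < |a|`, and `Q + a` is a nonzero multiple of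
`2^emin` with the sign of `a`; so is its rounding.  (`p = 1` is genuinely excluded:
`⟨−8, −16, −64, 128⟩` has estimate `0`, sum `40`.)

CONSEQUENCES (`p ≥ 2`, error-free two-products, any `RoundoffBelow 2` round-to-nearest):
`twoTwoProdDiff_estimate_faithful` (block `B` of `orient2dadapt`: `estimate B` is `> 0 / < 0 / = 0`
exactly when `ab − cd` is; `orient2dDetB` unfolds to it) and `orient2d_tailsZero_faithful` — at the
"all tails zero" exit the returned `det` is `> 0 / < 0 / = 0` exactly when the TRUE determinant is,
with no range or precision side condition (the question left open in `Orient2dEstimate(Zero)` and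
answered under extra hypotheses in `Orient2dTailsZero(Pos)`).  The stage-B tests of ORIENT3D /
INCIRCLE (`fin1` is a `W` expansion) are the intended next clients; not treated here.

Evidence gathered before the proof (exhaustive; ties-to-even; components `p`-bit floats `< 2^E`):
`p = 2, 3, 4, 5` (`E = 10, 9, 10, 10`, lengths `≤ 8, 6, 5, 5`; 2 789 033 / 355 829 / 406 528 /
516 928 `W`-lists): no `estimate = 0 ≠ Σ`, no wrong strict sign, largest `|estimate − Σ|/|Σ|`
`1.95u … 2.32u`; `p = 1`: 944 failures.  Reference: J. R. Shewchuk, Discrete Comput. Geom. 18 (1997)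
305–363, §2.7, §4.3 and `predicates.c` (`estimate`, `orient2dadapt`) [Shewchuk1997].
-/

namespace Summit.Ventures.CertifiedArithmetic.Expansions

open Literature.ComputerArithmetic.JeannerodRump2018
open Literature.ComputerArithmetic.BoldoJeannerodMelquiondMuller2023 hiding twoSum twoSum_fst
  isFloat_twoSum
open Literature.ComputerArithmetic.JoldesMullerPopescu2017 (isFloat_two_zpow abs_fl_le_of_abs_le)
open Literature.ComputerArithmetic.RumpOgitaOishi2008 (eq_zero_of_isFloat_of_abs_lt)
open Literature.ComputerArithmetic.Shewchuk1997

variable {p : ℕ} {emin : ℤ} {fl : ℚ → ℚ}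

/-- `estimate (l ++ [x]) = estimate l ⊕ x` for nonempty `l`. -/
theorem estimate_append_singleton (fl : ℚ → ℚ) {l : List ℚ} (hl : l ≠ []) (x : ℚ) :
    estimate fl (l ++ [x]) = fl (estimate fl l + x) := by
  obtain ⟨e, es, rfl⟩ := List.exists_cons_of_ne_nil hl
  simp [estimate, List.foldl_append]

/-- `estimate` of a list of floats is a float (`estimate [] = 0`). -/
theorem isFloat_estimate (hfl : IsRoundNearest p emin fl) :
    ∀ {l : List ℚ}, (∀ x ∈ l, IsFloat p emin x) → IsFloat p emin (estimate fl l) := by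
  intro l
  induction l using List.reverseRecOn with
  | nil => intro; exact ⟨0, emin, by simp, le_rfl, by simp [estimate]⟩
  | append_singleton l a ih =>
    intro h
    by_cases hl : l = []
    · subst hl; simpa [estimate] using h a (by simp)
    · rw [estimate_append_singleton fl hl]; exact (hfl _).1

/-- Trailing zeros do not change `estimate` (the running value is a float, `Q ⊕ 0 = Q`). -/
theorem estimate_append_of_forall_eq_zero (hfl : IsRoundNearest p emin fl) {l : List ℚ}
    (hl : l ≠ []) (hF : ∀ x ∈ l, IsFloat p emin x) :
    ∀ {z : List ℚ}, (∀ x ∈ z, x = 0) → estimate fl (l ++ z) = estimate fl l := by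
  intro z
  induction z using List.reverseRecOn with
  | nil => intro; rw [List.append_nil]
  | append_singleton z b ih =>
    intro hz
    have hb : b = 0 := hz b (by simp)
    have hz' : ∀ x ∈ z, x = 0 := fun x hx => hz x (by simp [hx])
    rw [← List.append_assoc, estimate_append_singleton fl (by simp [hl]) b, ih hz', hb, add_zero,
      fl_eq_self hfl (isFloat_estimate hfl hF)]

/-- **`|estimate| ≤ 2^s`** for a nonoverlapping expansion of floats all of whose components are
`< 2^s` in magnitude (`p ≥ 1`, any round-to-nearest).  By induction from the right: the top
component is `a = M·2^v` with `M` odd, the others are `< 2^v`, so their `estimate` is `≤ 2^v` and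
`|estimate + a| ≤ 2^v + (2^s − 2^v) = 2^s`, a float bound that rounding respects. -/
theorem abs_estimate_le_two_zpow (hp : 1 ≤ p) (hfl : IsRoundNearest p emin fl) :
    ∀ {l : List ℚ}, (∀ x ∈ l, IsFloat p emin x) → IsExpansion 1 l →
      ∀ {s : ℤ}, (∀ x ∈ l, |x| < (2 : ℚ) ^ s) → |estimate fl l| ≤ (2 : ℚ) ^ s := by
  intro l
  induction l using List.reverseRecOn with
  | nil =>
    intro _ _ s _
    rw [show estimate fl [] = 0 from rfl, abs_zero]; exact zpow_nonneg (by norm_num) _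
  | append_singleton l a ih =>
    intro hF hE s hs
    have h2s : (0 : ℚ) < (2 : ℚ) ^ s := zpow_pos (by norm_num) _
    have hFl : ∀ x ∈ l, IsFloat p emin x := fun x hx => hF x (by simp [hx])
    have hFa : IsFloat p emin a := hF a (by simp)
    have hEl : IsExpansion 1 l := (List.pairwise_append.mp hE).1
    have hbelow : ∀ x ∈ l, Below 1 x a := fun x hx =>
      (List.pairwise_append.mp hE).2.2 x hx a (by simp)
    have hsl : ∀ x ∈ l, |x| < (2 : ℚ) ^ s := fun x hx => hs x (by simp [hx])
    have hsa : |a| < (2 : ℚ) ^ s := hs a (by simp)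
    by_cases hl : l = []
    · subst hl; rw [show estimate fl ([] ++ [a]) = a from rfl]; exact hsa.le
    rw [estimate_append_singleton fl hl]
    have hQF : IsFloat p emin (estimate fl l) := isFloat_estimate hfl hFl
    rcases lt_or_ge s emin with hse | hse
    · -- below `2^emin` every float vanishes
      have hlt : (2 : ℚ) ^ s < (2 : ℚ) ^ emin := zpow_lt_zpow_right₀ (by norm_num) hse
      have ha0 : a = 0 := eq_zero_of_isFloat_of_abs_lt hFa (hsa.trans hlt)
      have hQ0 : estimate fl l = 0 :=
        eq_zero_of_isFloat_of_abs_lt hQF ((ih hFl hEl hsl).trans_lt hlt)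
      rw [ha0, add_zero, fl_eq_self hfl hQF, hQ0, abs_zero]; exact h2s.le
    by_cases ha0 : a = 0
    · rw [ha0, add_zero, fl_eq_self hfl hQF]; exact ih hFl hEl hsl
    obtain ⟨M, v, hMo, -, -, hav⟩ := exists_odd_mul_two_zpow hFa ha0
    -- every earlier component lies below `2^v`, hence so does their estimate
    have hv : ∀ x ∈ l, |x| < (2 : ℚ) ^ v := fun x hx => by
      obtain ⟨s', hs', hxs'⟩ := hbelow x hx
      rw [one_mul] at hxs'
      rw [hav] at hs'
      exact lt_of_lt_of_le hxs' (zpow_le_zpow_right₀ (by norm_num) (OnGrid.le_of_odd hMo hs'))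
    have hQv : |estimate fl l| ≤ (2 : ℚ) ^ v := ih hFl hEl hv
    have h2v : (0 : ℚ) < (2 : ℚ) ^ v := zpow_pos (by norm_num) _
    have hM0 : M ≠ 0 := by rintro rfl; obtain ⟨k, hk⟩ := hMo; omega
    have hM1 : (1 : ℚ) ≤ |(M : ℚ)| := by
      rw [← Int.cast_abs]; exact_mod_cast Int.one_le_abs hM0
    have hva : (2 : ℚ) ^ v ≤ |a| := by
      rw [hav, abs_mul, abs_of_pos h2v]; exact le_mul_of_one_le_left h2v.le hM1
    have hvs : v ≤ s := by
      by_contra hlt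
      rw [not_le] at hlt
      have : (2 : ℚ) ^ s ≤ (2 : ℚ) ^ v := zpow_le_zpow_right₀ (by norm_num) hlt.le
      linarith
    -- `a` and `2^s` are multiples of `2^v`, so `|a| ≤ 2^s − 2^v`
    have haG : OnGrid v a := ⟨M, hav⟩
    have hsG : OnGrid v ((2 : ℚ) ^ s) := OnGrid.two_zpow hvs
    have hup : a + (2 : ℚ) ^ v ≤ (2 : ℚ) ^ s := haG.add_two_zpow_le hsG (lt_of_abs_lt hsa)
    have hlo : -(2 : ℚ) ^ s + (2 : ℚ) ^ v ≤ a :=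
      hsG.neg.add_two_zpow_le haG (neg_lt_of_abs_lt hsa)
    have hQa : |estimate fl l + a| ≤ (2 : ℚ) ^ s := by
      obtain ⟨hQ1, hQ2⟩ := abs_le.mp hQv
      rw [abs_le]; constructor <;> linarith
    exact abs_fl_le_of_abs_le hfl (isFloat_two_zpow hp hse) hQa

/-- `3·2^e` is a float for `p ≥ 2`, `e ≥ emin`. -/
private theorem isFloat_three_mul_two_zpow (hp : 2 ≤ p) {e : ℤ} (he : emin ≤ e) :
    IsFloat p emin (3 * (2 : ℚ) ^ e) := by
  refine ⟨3, e, ?_, he, by push_cast; ring⟩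
  rw [abs_of_pos (by norm_num : (0 : ℤ) < 3)]
  calc (3 : ℤ) < 2 ^ 2 := by norm_num
    _ ≤ 2 ^ p := pow_le_pow_right₀ (by norm_num) hp

set_option maxHeartbeats 800000 in
/-- **`estimate` IS SIGN-FAITHFUL ON WEAKLY NONOVERLAPPING EXPANSIONS.**  For `p ≥ 2`, any
round-to-nearest `fl` into `F(p, emin)` and any list of floats with the `W` property (components
smallest first, zeros allowed): `estimate > 0 ↔ Σ > 0` and `estimate < 0 ↔ Σ < 0`. -/
theorem estimate_sign_of_isWeakExpansion (hp : 2 ≤ p) (hfl : IsRoundNearest p emin fl) :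
    ∀ {l : List ℚ}, (∀ x ∈ l, IsFloat p emin x) → IsWeakExpansion l →
      (0 < estimate fl l ↔ 0 < l.sum) ∧ (estimate fl l < 0 ↔ l.sum < 0) := by
  have hp1 : 1 ≤ p := le_trans (by norm_num) hp
  intro l
  induction l using List.reverseRecOn with
  | nil => intro _ _; simp [estimate]
  | append_singleton l a ih =>
    intro hF hW
    have hFl : ∀ x ∈ l, IsFloat p emin x := fun x hx => hF x (by simp [hx])
    have hFa : IsFloat p emin a := hF a (by simp)
    have hWl : IsWeakExpansion l := hW.sublist (List.sublist_append_left l [a])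
    rw [List.sum_append, List.sum_singleton]
    by_cases hl : l = []
    · subst hl; simp [estimate]
    rw [estimate_append_singleton fl hl]
    have hQF : IsFloat p emin (estimate fl l) := isFloat_estimate hfl hFl
    by_cases ha0 : a = 0
    · rw [ha0, add_zero, add_zero, fl_eq_self hfl hQF]; exact ih hFl hWl
    obtain ⟨M, v, hMo, -, -, hav⟩ := exists_odd_mul_two_zpow hFa ha0
    have h2v : (0 : ℚ) < (2 : ℚ) ^ v := zpow_pos (by norm_num) _
    have hWa : ∀ x ∈ l, WeakBelow x a := fun x hx =>
      (List.pairwise_append.mp hW.1).2.2 x hx a (by simp)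
    -- every earlier component lies below `2^v`: `Σ` has the sign of `a`
    have hv : ∀ x ∈ l, |x| < (2 : ℚ) ^ v := fun x hx => by
      obtain ⟨s', hs', hxs'⟩ := (hWa x hx).below_one
      rw [one_mul] at hxs'
      rw [hav] at hs'
      exact lt_of_lt_of_le hxs' (zpow_le_zpow_right₀ (by norm_num) (OnGrid.le_of_odd hMo hs'))
    have hsum : |l.sum| < (2 : ℚ) ^ v := abs_sum_lt_two_zpow_of_isExpansion hFl hWl.isExpansion hv
    have hM0 : M ≠ 0 := by rintro rfl; obtain ⟨k, hk⟩ := hMo; omega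
    have hM1 : (1 : ℤ) ≤ |M| := Int.one_le_abs hM0
    have habs : |a| = |(M : ℚ)| * (2 : ℚ) ^ v := by rw [hav, abs_mul, abs_of_pos h2v]
    have hva : (2 : ℚ) ^ v ≤ |a| := by
      rw [habs]
      have : (1 : ℚ) ≤ |(M : ℚ)| := by rw [← Int.cast_abs]; exact_mod_cast hM1
      exact le_mul_of_one_le_left h2v.le this
    -- KEY: the running sum of the others is smaller than `|a|`
    have hQa : |estimate fl l| < |a| := by
      have hQv : |estimate fl l| ≤ (2 : ℚ) ^ v :=
        abs_estimate_le_two_zpow hp1 hfl hFl hWl.isExpansion hv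
      by_cases hM : |M| = 1
      · -- `a = ± 2^v`
        have ha1 : |a| = (2 : ℚ) ^ v := by
          rw [habs, ← Int.cast_abs, hM]; push_cast; ring
        rw [ha1]
        have e1 : (2 : ℚ) ^ v = 2 * (2 : ℚ) ^ (v - 1) := by
          rw [mul_comm, ← zpow_add_one₀ (by norm_num : (2 : ℚ) ≠ 0), sub_add_cancel]
        have e2 : (2 : ℚ) ^ (v - 1) = 2 * (2 : ℚ) ^ (v - 2) := by
          rw [mul_comm, ← zpow_add_one₀ (by norm_num : (2 : ℚ) ≠ 0)]; ring_nf
        -- the others are `≤ 2^(v-1)`, and `< 2^(v-1)` unless one-bit of that size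
        have hsmall : ∀ x ∈ l, |x| < (2 : ℚ) ^ (v - 1) ∨ |x| = (2 : ℚ) ^ (v - 1) := by
          intro x hx
          rcases hWa x hx with hB2 | ⟨-, e, he⟩
          · left
            obtain ⟨s', hs', hxs'⟩ := hB2
            rw [hav] at hs'
            have : (2 : ℚ) ^ s' ≤ (2 : ℚ) ^ v :=
              zpow_le_zpow_right₀ (by norm_num) (OnGrid.le_of_odd hMo hs')
            linarith
          · have hxv := hv x hx
            rw [he] at hxv
            have hev : e ≤ v - 1 := by
              by_contra h
              rw [not_le] at h
              have : (2 : ℚ) ^ v ≤ (2 : ℚ) ^ e := zpow_le_zpow_right₀ (by norm_num) (by omega)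
              linarith
            rcases lt_or_eq_of_le hev with hlt | heq
            · left; rw [he]; exact zpow_lt_zpow_right₀ (by norm_num) hlt
            · right; rw [he, heq]
        by_cases hbig : ∃ x₀ ∈ l, |x₀| = (2 : ℚ) ^ (v - 1)
        · obtain ⟨x₀, hx₀, hx₀abs⟩ := hbig
          obtain ⟨l₁, l₂, rfl⟩ := List.append_of_mem hx₀
          have hF₁ : ∀ y ∈ l₁, IsFloat p emin y := fun y hy => hFl y (by simp [hy])
          have hFx₀ : IsFloat p emin x₀ := hFl x₀ (by simp)
          have hx₀0 : x₀ ≠ 0 := by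
            intro h; rw [h, abs_zero] at hx₀abs
            exact absurd hx₀abs (ne_of_lt (zpow_pos (by norm_num) _))
          -- `x₀ = σ·2^(v-1)` with `σ = ±1` odd
          have hx₀rep : ∃ σ : ℤ, Odd σ ∧ x₀ = (σ : ℚ) * (2 : ℚ) ^ (v - 1) := by
            rcases (abs_eq (zpow_nonneg (by norm_num) _)).mp hx₀abs with h | h
            · exact ⟨1, odd_one, by rw [h]; simp⟩
            · exact ⟨-1, by decide, by rw [h]; simp⟩
          obtain ⟨σ, hσo, hx₀σ⟩ := hx₀rep
          -- after `x₀` only zeros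
          have hl₂ : ∀ y ∈ l₂, y = 0 := by
            intro y hy
            have hWxy : WeakBelow x₀ y :=
              List.rel_of_pairwise_cons (List.pairwise_append.mp hWl.1).2.1 hy
            obtain ⟨s', hs', hxs'⟩ := hWxy.below_one
            rw [one_mul, hx₀abs] at hxs'
            by_contra hy0
            have h1 : (2 : ℚ) ^ s' ≤ |y| := hs'.two_zpow_le_abs hy0
            have h2 : |y| ≤ (2 : ℚ) ^ (v - 1) := by
              rcases hsmall y (by simp [hy]) with h | h
              · exact h.le
              · exact h.le
            linarith
          -- before `x₀` everything lies below `2^(v-2)` (no component is adjacent to two others)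
          have hl₁ : ∀ y ∈ l₁, |y| < (2 : ℚ) ^ (v - 2) := by
            intro y hy
            have hsub : [y, x₀, a].Sublist (l₁ ++ x₀ :: l₂ ++ [a]) :=
              ((List.singleton_sublist.mpr hy).append
                (List.cons_sublist_cons.mpr (List.nil_sublist l₂))).append (List.Sublist.refl [a])
            have hW3 : IsWeakExpansion [y, x₀, a] := hW.sublist hsub
            have hND : NoDouble y x₀ a :=
              List.rel_of_pairwise_cons (List.triplewise_cons.mp hW3.2).1 (by simp)
            rcases hND with ⟨s', hs', hys'⟩ | ⟨s', hs', hxs'⟩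
            · rw [hx₀σ] at hs'
              have : (2 : ℚ) ^ s' ≤ (2 : ℚ) ^ (v - 1) :=
                zpow_le_zpow_right₀ (by norm_num) (OnGrid.le_of_odd hσo hs')
              linarith
            · exfalso
              rw [hav] at hs'
              have : (2 : ℚ) ^ s' ≤ (2 : ℚ) ^ v :=
                zpow_le_zpow_right₀ (by norm_num) (OnGrid.le_of_odd hMo hs')
              rw [hx₀abs] at hxs'
              linarith
          -- so the running sum is `estimate (l₁ ++ [x₀])`, at most `2^(v-2) + 2^(v-1)`
          have hQeq : estimate fl (l₁ ++ x₀ :: l₂) = estimate fl (l₁ ++ [x₀]) := by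
            rw [show l₁ ++ x₀ :: l₂ = (l₁ ++ [x₀]) ++ l₂ by simp]
            exact estimate_append_of_forall_eq_zero hfl (by simp)
              (fun y hy => by
                rcases List.mem_append.mp hy with h | h
                · exact hF₁ y h
                · rw [List.mem_singleton.mp h]; exact hFx₀) hl₂
          rw [hQeq]
          by_cases hl₁0 : l₁ = []
          · subst hl₁0
            rw [show estimate fl ([] ++ [x₀]) = x₀ from rfl, hx₀abs]
            linarith
          rw [estimate_append_singleton fl hl₁0]
          have hE₁ : IsExpansion 1 l₁ := (List.pairwise_append.mp hWl.isExpansion).1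
          have hQ₁ : |estimate fl l₁| ≤ (2 : ℚ) ^ (v - 2) :=
            abs_estimate_le_two_zpow hp1 hfl hF₁ hE₁ hl₁
          have hQ₁F : IsFloat p emin (estimate fl l₁) := isFloat_estimate hfl hF₁
          rcases lt_or_ge (v - 2) emin with hve | hve
          · -- `estimate l₁` is a float below `2^emin`: zero
            have hlt : (2 : ℚ) ^ (v - 2) < (2 : ℚ) ^ emin := zpow_lt_zpow_right₀ (by norm_num) hve
            rw [eq_zero_of_isFloat_of_abs_lt hQ₁F (hQ₁.trans_lt hlt), zero_add,
              fl_eq_self hfl hFx₀, hx₀abs]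
            linarith
          · have h3 : |estimate fl l₁ + x₀| ≤ 3 * (2 : ℚ) ^ (v - 2) := by
              have := abs_add_le (estimate fl l₁) x₀
              rw [hx₀abs] at this
              linarith
            have := abs_fl_le_of_abs_le hfl (isFloat_three_mul_two_zpow hp hve) h3
            linarith
        · push Not at hbig
          have hv1 : ∀ x ∈ l, |x| < (2 : ℚ) ^ (v - 1) := fun x hx =>
            (hsmall x hx).resolve_right (hbig x hx)
          have := abs_estimate_le_two_zpow hp1 hfl hFl hWl.isExpansion hv1
          linarith
      · -- `|M| ≥ 2`: `|a| ≥ 2·2^v > 2^v ≥ |estimate|`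
        have hM2 : (2 : ℚ) ≤ |(M : ℚ)| := by
          have : (2 : ℤ) ≤ |M| := by
            have := lt_of_le_of_ne hM1 (Ne.symm hM); linarith
          rw [← Int.cast_abs]; exact_mod_cast this
        rw [habs]; nlinarith
    -- conclusion: `estimate + a` is a nonzero multiple of `2^emin` with the sign of `a`
    have hG : OnGrid emin (estimate fl l + a) := (OnGrid.of_isFloat hQF).add (OnGrid.of_isFloat hFa)
    rw [fl_pos_iff_of_onGrid hp1 hfl le_rfl hG, fl_neg_iff_of_onGrid hp1 hfl le_rfl hG]
    obtain ⟨hQ1, hQ2⟩ := abs_lt.mp hQa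
    obtain ⟨hS1, hS2⟩ := abs_lt.mp (hsum.trans_le hva)
    rcases lt_or_gt_of_ne ha0 with han | hap
    · rw [abs_of_neg han] at hQ1 hQ2 hS1 hS2
      exact ⟨⟨fun h => by linarith, fun h => by linarith⟩,
        ⟨fun _ => by linarith, fun _ => by linarith⟩⟩
    · rw [abs_of_pos hap] at hQ1 hQ2 hS1 hS2
      exact ⟨⟨fun _ => by linarith, fun _ => by linarith⟩,
        ⟨fun h => by linarith, fun h => by linarith⟩⟩

/-- **`estimate = 0 ↔ Σ = 0`** on weakly nonoverlapping expansions of floats (`p ≥ 2`): a zero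
`estimate` never hides a nonzero sum. -/
theorem estimate_eq_zero_iff_of_isWeakExpansion (hp : 2 ≤ p) (hfl : IsRoundNearest p emin fl)
    {l : List ℚ} (hF : ∀ x ∈ l, IsFloat p emin x) (hW : IsWeakExpansion l) :
    estimate fl l = 0 ↔ l.sum = 0 := by
  obtain ⟨h1, h2⟩ := estimate_sign_of_isWeakExpansion hp hfl hF hW
  rcases lt_trichotomy l.sum 0 with hs | hs | hs
  · exact iff_of_false (h2.mpr hs).ne hs.ne
  · refine iff_of_true (le_antisymm ?_ ?_) hs
    · exact not_lt.mp fun h => absurd (h1.mp h) (by rw [hs]; exact lt_irrefl 0)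
    · exact not_lt.mp fun h => absurd (h2.mp h) (by rw [hs]; exact lt_irrefl 0)
  · exact iff_of_false (h1.mpr hs).ne' hs.ne'

/-- **`estimate` on the block `B = TWO-TWO-DIFF(TWO-PRODUCT(a, b), TWO-PRODUCT(c, d))`** of
`orient2dadapt` (error-free two-products, `p ≥ 2`, any `RoundoffBelow 2` round-to-nearest): it is
`> 0`, `< 0`, `= 0` exactly when `ab − cd` is (the block is a `W` expansion of floats with sum
`ab − cd`, `twoTwoProdDiff_spec`). -/
theorem twoTwoProdDiff_estimate_faithful (hp : 2 ≤ p) (hfl : IsRoundNearest p emin fl)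
    (hfl2 : RoundoffBelow 2 fl) {tp : ℚ → ℚ → ℚ × ℚ} {a b c d : ℚ}
    (hab : ExactTwoProd p emin fl tp a b) (hcd : ExactTwoProd p emin fl tp c d) :
    (0 < estimate fl (twoTwoProdDiff tp fl a b c d) ↔ 0 < a * b - c * d) ∧
      (estimate fl (twoTwoProdDiff tp fl a b c d) < 0 ↔ a * b - c * d < 0) ∧
      (estimate fl (twoTwoProdDiff tp fl a b c d) = 0 ↔ a * b - c * d = 0) := by
  have hp1 : 1 ≤ p := le_trans (by norm_num) hp
  obtain ⟨hW, hS, -, hF⟩ := twoTwoProdDiff_spec hp1 hfl hfl2 hab hcd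
  rw [← hS]
  exact ⟨(estimate_sign_of_isWeakExpansion hp hfl hF hW).1,
    (estimate_sign_of_isWeakExpansion hp hfl hF hW).2,
    estimate_eq_zero_iff_of_isWeakExpansion hp hfl hF hW⟩

/-- **THE "ALL TAILS ZERO" EXIT OF `orient2dadapt` IS EXACTLY RIGHT** (`p ≥ 2`, error-free
two-products, any `RoundoffBelow 2` round-to-nearest, no range condition): if the four coordinate
differences are floats then the returned `det` is `> 0`, `< 0`, `= 0` exactly when the TRUE
determinant is — in particular a `0` never hides a nonzero determinant. -/
theorem orient2d_tailsZero_faithful (hp : 2 ≤ p) (hfl : IsRoundNearest p emin fl)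
    (hfl2 : RoundoffBelow 2 fl) {tp : ℚ → ℚ → ℚ × ℚ} {a₁ a₂ b₁ b₂ c₁ c₂ : ℚ}
    (h₁ : IsFloat p emin (a₁ - c₁)) (h₂ : IsFloat p emin (b₂ - c₂))
    (h₃ : IsFloat p emin (a₂ - c₂)) (h₄ : IsFloat p emin (b₁ - c₁))
    (h₁₂ : ExactTwoProd p emin fl tp (a₁ - c₁) (b₂ - c₂))
    (h₃₄ : ExactTwoProd p emin fl tp (a₂ - c₂) (b₁ - c₁)) :
    (0 < orient2dDetB tp fl a₁ a₂ b₁ b₂ c₁ c₂ ↔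
        0 < (a₁ - c₁) * (b₂ - c₂) - (a₂ - c₂) * (b₁ - c₁)) ∧
      (orient2dDetB tp fl a₁ a₂ b₁ b₂ c₁ c₂ < 0 ↔
        (a₁ - c₁) * (b₂ - c₂) - (a₂ - c₂) * (b₁ - c₁) < 0) ∧
      (orient2dDetB tp fl a₁ a₂ b₁ b₂ c₁ c₂ = 0 ↔
        (a₁ - c₁) * (b₂ - c₂) - (a₂ - c₂) * (b₁ - c₁) = 0) := by
  unfold orient2dDetB
  rw [fl_eq_self hfl h₁, fl_eq_self hfl h₂, fl_eq_self hfl h₃, fl_eq_self hfl h₄]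
  exact twoTwoProdDiff_estimate_faithful hp hfl hfl2 h₁₂ h₃₄

end Summit.Ventures.CertifiedArithmetic.Expansions
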